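import Literature.MathematicalPhysics.KineticTheory.ReyBelletThomas2002HormanderLift
import Literature.MathematicalPhysics.KineticTheory.ReyBelletThomas2002ForwardEquation
import Mathlib.Probability.Kernel.Composition.MeasureCompProd
import Mathlib.Probability.Kernel.Composition.IntegralCompProd
import HarnessLib

/-!
# Rey-Bellet–Thomas 2002: transition densities smooth in `(t, y)`, from Hörmander's theorem

Trunk T-KINETIC (Literature/MathematicalPhysics/KineticTheory). Inline decomposition step for the
named fact `ReyBelletThomas2002_thm21` (provefact unit): the part of its "`C^∞` law" clause that
follows from the hypoellipticity of the parabolic operator alone (§4 p. 26: "the Markov process has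
a `C^∞` law … This is a consequence of Hörmander Theorem [11, 16]"). For every
`S : MarkovSemigroupFor (P.rbGenerator Λ N T_L T_R)` — smooth potentials with H2, `Λ ≠ 0`, `γ > 0`,
`T_L, T_R > 0` — and every starting point `x`:

* `MarkovSemigroupFor.spaceTimeLaw S x = dt ⊗ P_t(x, dy)` on `(0, ∞) × X`, a locally finite
  measure; by the forward equation (`OscillatorChain.rb_forwardEquation`) and the identification
  `ᵗP̃ φ = ∂_tφ + L_yφ` of the transpose of the parabolic Hörmander operator
  `P̃ = X̃_L² + X̃_R² + X̃₀ + 2γ = L*_y - ∂_t` (`OscillatorChain.hormanderTranspose_rbParabolic`), its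
  distribution solves `P̃ u = 0` in `𝓓'((0,∞) × X)`;
* the bracket condition for `P̃` (`OscillatorChain.isBracketGenerating_rbParabolicFamily`) and
  Hörmander's Theorem 1.1 (named fact `Literature.Analysis.Distribution.Hormander1967_thm11`) make
  `u` a smooth function on `(0, ∞) × X`;
* **`OscillatorChain.rb_transitionDensity_of_hormander`**: hence there is
  `p ∈ C^∞((0,∞) × X)`, `p ≥ 0`, with `P_t(x, dy) = p(t, y) dy` for EVERY `t > 0` (from a.e. `t`
  to all `t` by the continuity of `t ↦ P_t b(x)` and of `t ↦ ∫ p(t, y) b(y) dy` for `b ∈ C_c^∞`).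

The joint regularity in the starting point `x` (the full clause `p_t(x, y) ∈ C^∞((0,∞) × X × X)`)
is NOT addressed here.

## References

* L. Rey-Bellet, L. E. Thomas, Comm. Math. Phys. **225** (2002) 305–329, Thm 2.1 and §4 p. 26.
* L. Hörmander, Acta Math. **119** (1967) 147–171, Thm 1.1.
-/

noncomputable section

open MeasureTheory ProbabilityTheory Filter Topology Set TopologicalSpace
open scoped NNReal ENNReal ContDiff Distributions

namespace Literature.MathematicalPhysics.KineticTheory.HeatConduction

open Literature.Analysis.Distribution

variable {N : ℕ}

/-! ### Transposes of constant fields and of lifted fields -/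

section Fields

variable {F : Type*} [NormedAddCommGroup F] [NormedSpace ℝ F]

/-- `ᵗX f = -X f` for a constant field. [folklore] -/
theorem fieldTranspose_const_apply (v : F) (f : F → ℝ) (x : F) :
    fieldTranspose (fun _ => v) f x = -fderiv ℝ f x v := by
  simp [fieldTranspose, fieldDeriv, fieldDiv]

/-- `ᵗX (ᵗX f) = X (X f)` for a constant field. [folklore] -/
theorem fieldTranspose_fieldTranspose_const_apply (v : F) (f : F → ℝ) (x : F) :
    fieldTranspose (fun _ => v) (fieldTranspose (fun _ => v) f) x =
      fderiv ℝ (fun y => fderiv ℝ f y v) x v := by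
  have h1 : fieldTranspose (fun _ : F => v) f = fun y => -fderiv ℝ f y v := by
    funext y; exact fieldTranspose_const_apply v f y
  rw [fieldTranspose_const_apply, h1, fderiv_fun_neg]
  simp

/-- Evaluation commutes with differentiation: `D[y ↦ Df(y)·v](x)·v = D²f(x)[v, v]` for `f ∈ C²`.
[folklore] -/
theorem fderiv_fderiv_apply_const {f : F → ℝ} (hf : ContDiff ℝ 2 f) (x v : F) :
    fderiv ℝ (fun y => fderiv ℝ f y v) x v = fderiv ℝ (fderiv ℝ f) x v v := by
  have hd : Differentiable ℝ (fderiv ℝ f) := (hf.fderiv_right (m := 1) (by norm_num)).differentiable one_ne_zero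
  rw [fderiv_clm_apply (hd x) (differentiableAt_const v)]
  simp

variable [FiniteDimensional ℝ F]

/-- The divergence of a lifted field is the divergence of the original one (the time row of its
derivative vanishes). [folklore] -/
theorem fieldDiv_liftField (a : ℝ) {V : F → F} {p : ℝ × F} (hV : DifferentiableAt ℝ V p.2) :
    fieldDiv (liftField a V) p = fieldDiv V p.2 := by
  unfold fieldDiv
  rw [(hasFDerivAt_liftField a hV).fderiv]
  have e : ((((0 : ℝ × F →L[ℝ] ℝ).prod ((fderiv ℝ V p.2).comp (ContinuousLinearMap.snd ℝ ℝ F))) :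
      ℝ × F →L[ℝ] ℝ × F) : ℝ × F →ₗ[ℝ] ℝ × F) =
      LinearMap.prodMap (0 : ℝ →ₗ[ℝ] ℝ) (fderiv ℝ V p.2 : F →ₗ[ℝ] F) := by
    refine LinearMap.ext fun q => ?_
    simp
  rw [e, LinearMap.trace_prodMap']
  simp

end Fields

/-! ### The transpose of the parabolic operator is `∂_t + L_y` -/

namespace OscillatorChain

variable (P : OscillatorChain)

/-- **`ᵗP̃ Ψ = ∂_tΨ + L_yΨ`** for the parabolic Hörmander operator
`P̃ = X̃_L² + X̃_R² + X̃₀ + 2γ` of the family `rbParabolicFamily` (`X̃_b = (0, X_b)` constant,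
`X̃₀ = (-1, -X₀)`, `div X̃₀ = div(-X₀) = 2γ`), smooth potentials, `γT_b ≥ 0`, `Ψ ∈ C^∞(ℝ × X)`.
[cite: ReyBelletThomas2002, §4] -/
theorem hormanderTranspose_rbParabolic (hU : ContDiff ℝ ∞ P.U) (hV : ContDiff ℝ ∞ P.V) (Λ : ℝ)
    {T_L T_R : ℝ} (hL : 0 ≤ P.γ * T_L) (hR : 0 ≤ P.γ * T_R) {Ψ : ℝ × RBPhaseSpace N → ℝ}
    (hΨ : ContDiff ℝ ∞ Ψ) (p : ℝ × RBPhaseSpace N) :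
    hormanderTranspose (P.rbParabolicFamily Λ N T_L T_R none)
        (fun b => P.rbParabolicFamily Λ N T_L T_R (some b)) (fun _ => 2 * P.γ) Ψ p =
      fderiv ℝ Ψ p (1, 0) + P.rbGenerator Λ N T_L T_R (fun y => Ψ (p.1, y)) p.2 := by
  obtain ⟨t, y⟩ := p
  have hΨ2 : ContDiff ℝ 2 Ψ := hΨ.of_le (by norm_cast)
  have hΨd : Differentiable ℝ Ψ := hΨ.differentiable (by simp)
  have hft : ContDiff ℝ ∞ (fun y' => Ψ (t, y')) := hΨ.comp (contDiff_const.prodMk contDiff_id)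
  have hft2 : ContDiff ℝ 2 (fun y' => Ψ (t, y')) := hft.of_le (by norm_cast)
  rw [P.rbGenerator_eq_hormanderOp Λ hL hR hft y, hormanderTranspose, hormanderOp]
  -- the noise fields: constant lifts
  have hb : ∀ b : Fin 2,
      fieldTranspose (P.rbParabolicFamily Λ N T_L T_R (some b))
        (fieldTranspose (P.rbParabolicFamily Λ N T_L T_R (some b)) Ψ) (t, y) =
      fieldDeriv (P.rbBathField (N := N) T_L T_R b)
        (fieldDeriv (P.rbBathField (N := N) T_L T_R b) fun y' => Ψ (t, y')) y := by
    intro b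
    set v : RBPhaseSpace N := P.rbBathField (N := N) T_L T_R b y with hv
    have e1 : P.rbParabolicFamily Λ N T_L T_R (some b) = fun _ => ((0 : ℝ), v) := by
      funext q; rfl
    have e3 : fieldDeriv (P.rbBathField (N := N) T_L T_R b)
        (fieldDeriv (P.rbBathField (N := N) T_L T_R b) fun y' => Ψ (t, y')) y =
        fderiv ℝ (fun y' => fderiv ℝ (fun y'' => Ψ (t, y'')) y' v) y v := rfl
    rw [e1, fieldTranspose_fieldTranspose_const_apply, e3, fderiv_fderiv_apply_const hft2,
      fderiv_fderiv_spaceSlice_apply hΨ2 t y]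
  -- the drift
  have h0 : fieldTranspose (P.rbParabolicFamily Λ N T_L T_R none) Ψ (t, y) =
      fderiv ℝ Ψ (t, y) (1, 0) + fieldDeriv (P.rbDrift Λ N) (fun y' => Ψ (t, y')) y -
        2 * P.γ * Ψ (t, y) := by
    have hdiv : fieldDiv (P.rbParabolicFamily Λ N T_L T_R none) (t, y) = 2 * P.γ := by
      have e1 : P.rbParabolicFamily Λ N T_L T_R none = liftField (-1) fun y' => -P.rbDrift Λ N y' := rfl
      have hXd : Differentiable ℝ (P.rbDrift Λ N) := (P.contDiff_rbDrift hU hV Λ N).differentiable (by simp)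
      have hXd' : DifferentiableAt ℝ (fun y' => -P.rbDrift Λ N y') y := (hXd y).neg
      rw [e1, fieldDiv_liftField (-1) (p := (t, y)) hXd']
      show LinearMap.trace ℝ _ (fderiv ℝ (fun y' => -P.rbDrift Λ N y') y : RBPhaseSpace N →ₗ[ℝ] RBPhaseSpace N) = _
      rw [fderiv_fun_neg]
      simp only [ContinuousLinearMap.toLinearMap_neg, map_neg]
      rw [show LinearMap.trace ℝ _ (fderiv ℝ (P.rbDrift Λ N) y : RBPhaseSpace N →ₗ[ℝ] RBPhaseSpace N)
        = fieldDiv (P.rbDrift Λ N) y from rfl, P.fieldDiv_rbDrift hU hV Λ N]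
      ring
    rw [fieldTranspose, hdiv, fieldDeriv, fieldDeriv, rbParabolicFamily_none]
    have e2 : ((-1 : ℝ), -P.rbDrift Λ N y) = -(((1 : ℝ), (0 : RBPhaseSpace N)) + ((0 : ℝ), P.rbDrift Λ N y)) := by
      simp
    rw [show ((t, y) : ℝ × RBPhaseSpace N).2 = y from rfl, e2, map_neg, map_add,
      fderiv_spaceSlice_apply hΨd t y]
    ring
  rw [Finset.sum_congr rfl fun b _ => hb b, h0]
  simp only [zero_mul, add_zero]
  ring

end OscillatorChain

/-! ### The space-time law of the process started at `x` -/

namespace MarkovSemigroupFor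

variable {X : Type*} [MeasurableSpace X] [NormedAddCommGroup X] [NormedSpace ℝ X]
  {L : (X → ℝ) → X → ℝ} (S : MarkovSemigroupFor L)

/-- The kernel `t ↦ P_{t⁺}(x, ·)` from real times. [folklore] -/
def timeKernel (x : X) : Kernel ℝ X :=
  ⟨fun t => S.kernel t.toNNReal x,
    S.measurable_kernel.comp (measurable_real_toNNReal.prodMk measurable_const)⟩

/-- Unfolding `timeKernel`. [folklore] -/
@[simp] theorem timeKernel_apply (x : X) (t : ℝ) : S.timeKernel x t = S.kernel t.toNNReal x := rfl

/-- The time kernel is a Markov kernel. [folklore] -/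
instance isMarkovKernel_timeKernel (x : X) : IsMarkovKernel (S.timeKernel x) :=
  ⟨fun t => by rw [timeKernel_apply]; infer_instance⟩

/-- **The space-time law** `dt ⊗ P_t(x, dy)` on `(0, ∞) × X` of the process started at `x`.
[folklore] -/
def spaceTimeLaw (x : X) : Measure (ℝ × X) :=
  (volume.restrict (Ioi (0 : ℝ))) ⊗ₘ S.timeKernel x

/-- The space-time law of a time slab: `(dt ⊗ P_t(x, ·))(s × A) = ∫_{s ∩ (0,∞)} P_t(x, A) dt`.
[folklore] -/
theorem spaceTimeLaw_apply_prod (x : X) {s : Set ℝ} (hs : MeasurableSet s) {A : Set X}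
    (hA : MeasurableSet A) :
    S.spaceTimeLaw x (s ×ˢ A) = ∫⁻ t in s, S.kernel t.toNNReal x A ∂(volume.restrict (Ioi (0 : ℝ))) := by
  rw [spaceTimeLaw, Measure.compProd_apply_prod hs hA]
  rfl

/-- The space-time law is locally finite (a time slab of length `ℓ` has mass `≤ ℓ`). [folklore] -/
instance isLocallyFiniteMeasure_spaceTimeLaw (x : X) : IsLocallyFiniteMeasure (S.spaceTimeLaw x) := by
  refine ⟨fun p => ⟨Ioo (p.1 - 1) (p.1 + 1) ×ˢ univ, prod_mem_nhds (Ioo_mem_nhds (by linarith) (by linarith))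
    univ_mem, ?_⟩⟩
  rw [S.spaceTimeLaw_apply_prod x measurableSet_Ioo MeasurableSet.univ]
  calc ∫⁻ t in Ioo (p.1 - 1) (p.1 + 1), S.kernel t.toNNReal x univ ∂(volume.restrict (Ioi (0 : ℝ)))
      = ∫⁻ _ in Ioo (p.1 - 1) (p.1 + 1), 1 ∂(volume.restrict (Ioi (0 : ℝ))) := by
        refine lintegral_congr fun t => ?_
        exact measure_univ
    _ = (volume.restrict (Ioi (0 : ℝ))) (Ioo (p.1 - 1) (p.1 + 1)) := by
        rw [setLIntegral_const, one_mul]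
    _ ≤ volume (Ioo (p.1 - 1) (p.1 + 1)) := Measure.restrict_apply_le _ _
    _ < ⊤ := by rw [Real.volume_Ioo]; exact ENNReal.ofReal_lt_top

/-- Integration against the space-time law: `∫ f d(dt ⊗ P_t(x,·)) = ∫_{t>0} ∫ f(t, y) P_t(x, dy) dt`.
[folklore] -/
theorem integral_spaceTimeLaw (x : X) {f : ℝ × X → ℝ} (hf : Integrable f (S.spaceTimeLaw x)) :
    ∫ p, f p ∂(S.spaceTimeLaw x) = ∫ t in Ioi (0 : ℝ), S.act t.toNNReal (fun y => f (t, y)) x := by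
  rw [spaceTimeLaw, Measure.integral_compProd hf]
  rfl

end MarkovSemigroupFor

/-! ### Transition densities smooth in `(t, y)` -/

namespace OscillatorChain

variable (P : OscillatorChain)

/-- `t ↦ P_t b(x)` is continuous on `(0, ∞)` for `b ∈ C_c^∞` (Lipschitz, Dynkin). [folklore] -/
theorem continuousOn_act_of_smooth (hU : ContDiff ℝ 1 P.U) (hV : ContDiff ℝ 1 P.V) {Λ : ℝ}
    {T_L T_R : ℝ} (S : MarkovSemigroupFor (P.rbGenerator Λ N T_L T_R)) {b : RBPhaseSpace N → ℝ}
    (hb : ContDiff ℝ ∞ b) (hbc : HasCompactSupport b) (x : RBPhaseSpace N) :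
    ContinuousOn (fun t : ℝ => S.act t.toNNReal b x) (Ioi 0) := by
  have hb2 : ContDiff ℝ 2 b := hb.of_le (by norm_cast)
  obtain ⟨C, hC⟩ := P.exists_bound_rbGenerator hU hV Λ N T_L T_R hb2 hbc
  have hLc := P.continuous_rbGenerator hU hV Λ N T_L T_R hb2
  have hC0 : 0 ≤ C := (norm_nonneg _).trans (hC x)
  refine Metric.continuousOn_iff.2 fun t ht ε hε => ⟨ε / (C + 1), by positivity, fun s hs hst => ?_⟩
  rw [Real.dist_eq] at hst ⊢
  have h := S.abs_act_sub_act_le hb hbc hLc hC s.toNNReal t.toNNReal x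
  rw [Real.coe_toNNReal _ (le_of_lt hs), Real.coe_toNNReal _ (le_of_lt ht)] at h
  calc |S.act s.toNNReal b x - S.act t.toNNReal b x| ≤ C * |s - t| := h
    _ ≤ C * (ε / (C + 1)) := mul_le_mul_of_nonneg_left hst.le hC0
    _ = ε * (C / (C + 1)) := by ring
    _ < ε := mul_lt_of_lt_one_right hε ((div_lt_one (by positivity)).2 (by linarith))

/-- **Transition densities smooth in `(t, y)`, from Hörmander's Theorem 1.1** (the `(t, y)`-part
of the "`C^∞` law" of Thm 2.1, §4 p. 26): for smooth potentials with **H2**, `Λ ≠ 0`, `γ > 0`,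
`T_L, T_R > 0`, every `S : MarkovSemigroupFor (P.rbGenerator Λ N T_L T_R)` and every `x`, there is
`p ∈ C^∞((0,∞) × X)`, `p ≥ 0` there, with `P_t(x, dy) = p(t, y) dy` for every `t > 0`. Proof: the
space-time law `dt ⊗ P_t(x, dy)` solves `P̃ u = 0` in `𝓓'((0,∞) × X)` for the parabolic
Hörmander operator `P̃` (`ᵗP̃ = ∂_t + L_y`, forward equation), whose family is bracket generating;
hypoellipticity gives a smooth density on `(0,∞) × X`; slicing in `t` (a.e. `t` by testing
products, then every `t` by continuity in `t` of both sides) identifies `P_t(x, ·)`.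
[cite: ReyBelletThomas2002, Thm 2.1] -/
theorem rb_transitionDensity_of_hormander (hH : Hormander1967_thm11) (hU : ContDiff ℝ ∞ P.U)
    (hV : ContDiff ℝ ∞ P.V) (hV2 : RBNondegenerate P.V) (hγ : 0 < P.γ) {Λ : ℝ} (hΛ : Λ ≠ 0)
    {T_L T_R : ℝ} (hL : 0 < T_L) (hR : 0 < T_R) (S : MarkovSemigroupFor (P.rbGenerator Λ N T_L T_R))
    (x : RBPhaseSpace N) :
    ∃ p : ℝ → RBPhaseSpace N → ℝ,
      ContDiffOn ℝ ∞ (fun w : ℝ × RBPhaseSpace N => p w.1 w.2) (Set.Ioi (0 : ℝ) ×ˢ Set.univ) ∧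
      (∀ t : ℝ, 0 < t → ∀ y, 0 ≤ p t y) ∧
      ∀ t : ℝ≥0, 0 < t →
        S.kernel t x = (volume : Measure (RBPhaseSpace N)).withDensity fun y => ENNReal.ofReal (p t y) := by
  haveI := isAddHaarMeasure_volume_rbPhaseSpace N
  haveI : (volume : Measure (ℝ × RBPhaseSpace N)).IsAddHaarMeasure :=
    Measure.prod.instIsAddHaarMeasure _ _
  have hγL : 0 < P.γ * T_L := mul_pos hγ hL
  have hγR : 0 < P.γ * T_R := mul_pos hγ hR
  -- the parabolic family, its smoothness and bracket condition
  set X₀ : ℝ × RBPhaseSpace N → ℝ × RBPhaseSpace N := P.rbParabolicFamily Λ N T_L T_R none with hX₀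
  set Xb : Fin 2 → ℝ × RBPhaseSpace N → ℝ × RBPhaseSpace N :=
    fun b => P.rbParabolicFamily Λ N T_L T_R (some b) with hXb
  have hfam : (fun o : Option (Fin 2) => o.elim X₀ Xb) = P.rbParabolicFamily Λ N T_L T_R := by
    funext o; cases o <;> rfl
  have hX₀s : ContDiff ℝ ∞ X₀ := P.contDiff_rbParabolicFamily hU hV Λ N T_L T_R none
  have hXbs : ∀ b, ContDiff ℝ ∞ (Xb b) := fun b => P.contDiff_rbParabolicFamily hU hV Λ N T_L T_R (some b)
  have hbr : IsBracketGenerating (fun o : Option (Fin 2) => o.elim X₀ Xb)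
      ((⊤ : Opens (ℝ × RBPhaseSpace N)) : Set (ℝ × RBPhaseSpace N)) := by
    rw [hfam, Opens.coe_top]
    exact P.isBracketGenerating_rbParabolicFamily hU hV hV2 hΛ hγL hγR
  have hyp := hH (ℝ × RBPhaseSpace N) volume (Fin 2) ⊤ X₀ Xb (fun _ => 2 * P.γ) hX₀s hXbs
    contDiff_const hbr
  -- the space-time law solves `P̃ u = 0` on `(0, ∞) × X`
  set U : Set (ℝ × RBPhaseSpace N) := Set.Ioi (0 : ℝ) ×ˢ Set.univ with hUdef
  have hUo : IsOpen U := isOpen_Ioi.prod isOpen_univ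
  have himg : Literature.Analysis.Distribution.ImageIsSmoothOn (measureDistribution (S.spaceTimeLaw x) ⊤)
      (hormanderTranspose X₀ Xb fun _ => 2 * P.γ) volume U := by
    refine ⟨0, contDiffOn_const, fun φ ψ hφU hψ => ?_⟩
    rw [measureDistribution_apply]
    simp only [Pi.zero_apply, zero_mul, integral_zero]
    have hψ' : ∀ q, ψ q = fderiv ℝ φ q (1, 0) + P.rbGenerator Λ N T_L T_R (fun y => φ (q.1, y)) q.2 := by
      intro q
      have := congrFun hψ q
      rw [this]
      exact P.hormanderTranspose_rbParabolic hU hV Λ hγL.le hγR.le φ.contDiff q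
    have hint : Integrable (fun q => (ψ : ℝ × RBPhaseSpace N → ℝ) q) (S.spaceTimeLaw x) :=
      ψ.contDiff.continuous.integrable_of_hasCompactSupport ψ.hasCompactSupport
    rw [S.integral_spaceTimeLaw x hint]
    simp only [hψ']
    exact P.rb_forwardEquation hU hV hγL.le hγR.le S φ.contDiff φ.hasCompactSupport hφU x
  obtain ⟨g, hg, hgint⟩ := hyp (measureDistribution (S.spaceTimeLaw x) ⊤) U hUo (subset_univ _) himg
  -- the density and its slices
  refine ⟨fun t y => g (t, y), hg, ?_⟩
  have hgc : ContinuousOn g U := hg.continuousOn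
  have hslice_cont : ∀ t : ℝ, 0 < t → Continuous fun y => g (t, y) := fun t ht =>
    (hgc.comp_continuous (Continuous.prodMk_right t) fun y => ⟨ht, mem_univ _⟩)
  -- testing products `a(t) b(y)`
  have hkey : ∀ {b : RBPhaseSpace N → ℝ}, ContDiff ℝ ∞ b → HasCompactSupport b →
      ∀ t : ℝ, 0 < t → S.act t.toNNReal b x = ∫ y, g (t, y) * b y := by
    intro b hb hbc
    -- both sides are continuous on `(0, ∞)`
    set Fb : ℝ → ℝ := fun t => S.act t.toNNReal b x with hFb
    set Gb : ℝ → ℝ := fun t => ∫ y, g (t, y) * b y with hGb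
    have hFc : ContinuousOn Fb (Ioi 0) :=
      P.continuousOn_act_of_smooth (hU.of_le (by norm_cast)) (hV.of_le (by norm_cast)) S hb hbc x
    have hbi : Integrable b volume := hb.continuous.integrable_of_hasCompactSupport hbc
    have hGc : ContinuousOn Gb (Ioi 0) := by
      intro t₀ ht₀
      have ht₀' : (0 : ℝ) < t₀ := ht₀
      have ht₀2 : 0 < t₀ / 2 := by linarith
      -- a uniform bound of `g` on `[t₀/2, t₀+1] × tsupport b`
      have hK : IsCompact (Icc (t₀ / 2) (t₀ + 1) ×ˢ tsupport b) := isCompact_Icc.prod hbc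
      have hKU : Icc (t₀ / 2) (t₀ + 1) ×ˢ tsupport b ⊆ U := fun q hq =>
        ⟨lt_of_lt_of_le ht₀2 hq.1.1, mem_univ _⟩
      obtain ⟨M, hM⟩ := hK.exists_bound_of_continuousOn (hgc.mono hKU)
      refine (continuousAt_of_dominated (bound := fun y => max M 0 * ‖b y‖) ?_ ?_
        (hbi.norm.const_mul _) ?_).continuousWithinAt
      · filter_upwards [Ioi_mem_nhds ht₀] with t ht
        exact ((hslice_cont t ht).mul hb.continuous).aestronglyMeasurable
      · filter_upwards [Ioo_mem_nhds (show t₀ / 2 < t₀ by linarith) (show t₀ < t₀ + 1 by linarith)]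
          with t ht
        refine Eventually.of_forall fun y => ?_
        rw [norm_mul]
        by_cases hy : y ∈ tsupport b
        · exact mul_le_mul_of_nonneg_right ((hM (t, y) ⟨⟨ht.1.le, ht.2.le⟩, hy⟩).trans
            (le_max_left _ _)) (norm_nonneg _)
        · rw [image_eq_zero_of_notMem_tsupport hy, norm_zero, mul_zero, mul_zero]
      · refine Eventually.of_forall fun y => ?_
        have hga : ContinuousAt g (t₀, y) := hgc.continuousAt (hUo.mem_nhds ⟨ht₀, mem_univ _⟩)
        exact ((ContinuousAt.comp (f := fun t : ℝ => (t, y)) (x := t₀) hga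
          (Continuous.prodMk_left y).continuousAt).mul continuousAt_const)
    -- testing against `a(t) b(y)` with `a ∈ C_c^∞((0, ∞))`
    have htest : ∀ a : ℝ → ℝ, ContDiff ℝ ∞ a → HasCompactSupport a → tsupport a ⊆ Ioi 0 →
        ∫ t, a t • (Fb t - Gb t) = 0 := by
      intro a ha hac haU
      set φ : ℝ × RBPhaseSpace N → ℝ := fun q => a q.1 * b q.2 with hφ
      have hφs : ContDiff ℝ ∞ φ := (ha.comp contDiff_fst).mul (hb.comp contDiff_snd)
      have hsupp : tsupport φ ⊆ tsupport a ×ˢ tsupport b := by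
        refine closure_minimal (fun q hq => ?_) ((isClosed_tsupport _).prod (isClosed_tsupport _))
        have h := Function.mem_support.1 hq
        exact ⟨subset_tsupport _ (Function.mem_support.2 (left_ne_zero_of_mul h)),
          subset_tsupport _ (Function.mem_support.2 (right_ne_zero_of_mul h))⟩
      have hφc : HasCompactSupport φ :=
        IsCompact.of_isClosed_subset (hac.isCompact.prod hbc.isCompact) (isClosed_tsupport _) hsupp
      have hφU : tsupport φ ⊆ U := hsupp.trans (prod_mono haU (subset_univ _))
      let Φ : 𝓓((⊤ : Opens (ℝ × RBPhaseSpace N)), ℝ) := ⟨φ, hφs, hφc, fun _ _ => trivial⟩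
      have hΦ := hgint Φ hφU
      rw [measureDistribution_apply] at hΦ
      -- left side: `∫ φ dm = ∫_{t>0} a(t) F_b(t) dt`
      have hintm : Integrable φ (S.spaceTimeLaw x) :=
        hφs.continuous.integrable_of_hasCompactSupport hφc
      have hleft : ∫ q, (Φ : ℝ × RBPhaseSpace N → ℝ) q ∂(S.spaceTimeLaw x) =
          ∫ t in Ioi (0 : ℝ), a t * Fb t := by
        change ∫ q, φ q ∂(S.spaceTimeLaw x) = _
        rw [S.integral_spaceTimeLaw x hintm]
        refine setIntegral_congr_fun measurableSet_Ioi fun t _ => ?_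
        simp only [hφ, hFb, MarkovSemigroupFor.act_apply]
        exact integral_const_mul (a t) b
      -- right side: `∫ g φ dvol = ∫ a(t) G_b(t) dt`
      have hgφc : Continuous fun q => g q * φ q := by
        refine continuous_iff_continuousAt.2 fun q => ?_
        by_cases hq : q ∈ U
        · exact (hgc.continuousAt (hUo.mem_nhds hq)).mul hφs.continuous.continuousAt
        · have hq' : q ∉ tsupport φ := fun h => hq (hφU h)
          have h0 : (fun q => g q * φ q) =ᶠ[𝓝 q] fun _ => 0 := by
            have hopen : IsOpen (tsupport φ)ᶜ := (isClosed_tsupport φ).isOpen_compl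
            filter_upwards [hopen.mem_nhds hq'] with r hr
            rw [image_eq_zero_of_notMem_tsupport hr, mul_zero]
          exact h0.continuousAt
      have hgφi : Integrable (fun q => g q * φ q) (volume : Measure (ℝ × RBPhaseSpace N)) :=
        hgφc.integrable_of_hasCompactSupport (show HasCompactSupport (g * φ) from hφc.mul_left)
      have hright : ∫ q, g q * (Φ : ℝ × RBPhaseSpace N → ℝ) q ∂(volume : Measure (ℝ × RBPhaseSpace N)) =
          ∫ t in Ioi (0 : ℝ), a t * Gb t := by
        change ∫ q, g q * φ q ∂(volume : Measure (ℝ × RBPhaseSpace N)) = _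
        rw [show (volume : Measure (ℝ × RBPhaseSpace N)) = (volume : Measure ℝ).prod volume from rfl,
          integral_prod _ hgφi]
        rw [← setIntegral_eq_integral_of_forall_compl_eq_zero (s := Ioi (0 : ℝ)) fun t ht => ?_]
        · refine setIntegral_congr_fun measurableSet_Ioi fun t _ => ?_
          simp only [hφ, hGb]
          rw [← integral_const_mul]
          refine integral_congr_ae (Eventually.of_forall fun y => ?_)
          simp only
          ring
        · have hat : a t = 0 := image_eq_zero_of_notMem_tsupport fun h => ht (haU h)
          simp [hφ, hat]
      have heq : ∫ t in Ioi (0 : ℝ), a t * Fb t = ∫ t in Ioi (0 : ℝ), a t * Gb t := by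
        rw [← hleft, ← hright]; exact hΦ
      -- conclude
      have hvan : ∀ {Hb : ℝ → ℝ}, ∀ t ∈ Ioi (0 : ℝ) \ tsupport a, a t * Hb t = 0 := fun t ht => by
        rw [image_eq_zero_of_notMem_tsupport ht.2, zero_mul]
      have hFi : IntegrableOn (fun t => a t * Fb t) (Ioi 0) volume :=
        (((ha.continuous.continuousOn).mul (hFc.mono haU)).integrableOn_compact hac.isCompact)
          |>.of_forall_sdiff_eq_zero measurableSet_Ioi hvan
      have hGi : IntegrableOn (fun t => a t * Gb t) (Ioi 0) volume :=
        (((ha.continuous.continuousOn).mul (hGc.mono haU)).integrableOn_compact hac.isCompact)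
          |>.of_forall_sdiff_eq_zero measurableSet_Ioi hvan
      rw [← setIntegral_eq_integral_of_forall_compl_eq_zero (s := Ioi (0 : ℝ)) fun t ht => by
        have hat : a t = 0 := image_eq_zero_of_notMem_tsupport fun h => ht (haU h)
        simp [hat]]
      simp only [smul_eq_mul, mul_sub]
      rw [integral_sub hFi hGi, heq, sub_self]
    -- a.e. equality on `(0, ∞)`, then everywhere by continuity
    have hae := isOpen_Ioi.ae_eq_zero_of_integral_contDiff_smul_eq_zero
      ((hFc.sub hGc).locallyIntegrableOn measurableSet_Ioi) htest
    have hae' : Fb =ᵐ[volume.restrict (Ioi (0 : ℝ))] Gb :=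
      (ae_restrict_iff' measurableSet_Ioi).2 (hae.mono fun t ht htI => sub_eq_zero.1 (ht htI))
    have hEq : EqOn Fb Gb (Ioi 0) := Measure.eqOn_open_of_ae_eq hae' isOpen_Ioi hFc hGc
    exact fun t ht => hEq ht
  -- slicing: every `P_t(x, ·)`, `t > 0`, has the density `g(t, ·) ≥ 0`
  have hboth : ∀ t : ℝ, 0 < t → (∀ y, 0 ≤ g (t, y)) ∧
      S.kernel t.toNNReal x = (volume : Measure (RBPhaseSpace N)).withDensity
        fun y => ENNReal.ofReal (g (t, y)) := fun t ht =>
    eq_withDensity_of_forall_integral_eq (m := S.kernel t.toNNReal x) volume (hslice_cont t ht)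
      fun b hb hbc => hkey hb hbc t ht
  refine ⟨fun t ht => (hboth t ht).1, fun t ht => ?_⟩
  have h := (hboth t (by exact_mod_cast ht)).2
  rwa [Real.toNNReal_coe] at h

end OscillatorChain

end Literature.MathematicalPhysics.KineticTheory.HeatConduction
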